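import Mathlib
import Literature.Analysis.FluidPDE.VectorCalculus
import Literature.Analysis.FluidPDE.PolynomialFieldCertificates
import Summits.NavierStokesRegularity.NavierStokesRegularity.Theorems.ThreadingFluxAzimuthalCartanDefs
import Summits.NavierStokesRegularity.NavierStokesRegularity.Theorems.SoloRefuteDou2026c
import HarnessLib

/-!
# Crux `PoloidalLiouville` (stmt-NavierStokesRegularity-1222, wall W1), crux idea «azimuthal-cartan-test» (ns-idea-15 g10,
# `Cruxes/PoloidalLiouville/AzimuthalCartanSketch.lean` v1.3c): the POISEUILLE BASE FACTS (L′) BY NAME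

Support file (Theorems-side; seat ns-wall-eng-6 g4, cell `ns-wall-extremal`, W1 adjunct; `--supports stmt-NavierStokesRegularity-1222
--as helper`; 0 kit).  The sketch's Prop `PoloidalLiouville.AzimuthalCartan.PoiseuilleBaseFacts` (v1.3c l.284, Defs twin verbatim) — the
Hagen–Poiseuille base `poiseuille = −(x₀² + x₁²) e₃`, `poiseuillePressure = −4x₂` is an ADMISSIBLE AXISYMMETRIC BASE on `ball xTest 1` about
`(0, J₃)` (analytic, classical steady Navier–Stokes, `J₃` skew and non-zero, infinitesimally `J₃`-equivariant, no swirl, `curl V (xTest) =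
(0, 6, 0) ≠ 0`) and is NOT `(−1)`-homogeneous about `0` (`DV(xTest) xTest = 2 V(xTest) ≠ −V(xTest)`) — as a kernel theorem:

* `AzimuthalCartan.poiseuilleBaseFacts : PoiseuilleBaseFacts`.

This is the `hL` input of the sketch's glue `ballRigidity_refuted : PoiseuilleJordanMode → PoiseuilleBaseFacts → ¬ InfinitesimalRigidityOffCentreBall`;
the other input J♭ `PoiseuilleJordanMode` (the explicit `φ`-linear mode) is a separate file.  Tools: the tree's polynomial-field calculus
`Literature.Analysis.FluidPDE.PolyFieldCert` (`polyField`, `fderiv_polyField_apply`, `divergence_polyField`, `laplacian_polyField_apply`,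
`gradient_toFun_apply`) after `poiseuille = polyField poisP`; «a derivation kills numerals» is the tree's `Dou2026c.pderiv_ofNat`
(`SoloRefuteDou2026c.lean`, imported — not restated).

HONEST LABEL: routine facts about an explicit polynomial flow (information-grade); `InfinitesimalRigidityOffCentreBall` is refuted only once
J♭ lands; `PoloidalLiouville` (1222), its steady stratum and NS regularity remain OPEN and untouched.
[cite: MajdaBertozziCUP2002, §1.1 (vector identities)]
-/

-- the summit and its single problem share the name (D-0017 nested layout)
set_option linter.dupNamespace false

noncomputable section

open Set Function Filter Metric
open scoped RealInnerProductSpace Topology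
open Literature.Analysis.FluidPDE Literature.Analysis.Calculus.MvPoly Literature.Analysis.FluidPDE.PolyFieldCert
open Summit.NavierStokesRegularity.NavierStokesRegularity.Theorems.PoloidalLiouville.CentreJet (E3 IsUnthreadedAbout IsSteadyNSOn)

namespace Summit.NavierStokesRegularity.NavierStokesRegularity.Theorems.PoloidalLiouville.AzimuthalCartan

namespace Poiseuille

open MvPolynomial in
/-- The Poiseuille polynomials: components `0, 0, −(X₀² + X₁²)`. -/
def poisP : Fin 3 → MvPolynomial (Fin 3) ℝ := ![0, 0, -(X 0 ^ 2 + X 1 ^ 2)]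

open MvPolynomial in
/-- The Poiseuille pressure polynomial `−4 X₂`. -/
def poisQ : MvPolynomial (Fin 3) ℝ := C (-4) * X 2

/-- The Poiseuille field is the polynomial field of `poisP`. -/
theorem poiseuille_eq_polyField : poiseuille = polyField poisP := by
  funext x; ext i
  fin_cases i <;> simp [poiseuille, poisP, polyField_apply, toFun_apply]

/-- The Poiseuille pressure is the polynomial function of `poisQ`. -/
theorem poiseuillePressure_eq_toFun : poiseuillePressure = toFun poisQ := by
  funext x
  simp [poiseuillePressure, poisQ, toFun_apply]


/-- `∂₀P₂ = −2X₀`. -/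
theorem pderiv_zero_poisP_two : MvPolynomial.pderiv 0 (poisP 2) = -(2 * MvPolynomial.X 0) := by
  simp [poisP, Derivation.leibniz_pow]
/-- `∂₁P₂ = −2X₁`. -/
theorem pderiv_one_poisP_two : MvPolynomial.pderiv 1 (poisP 2) = -(2 * MvPolynomial.X 1) := by
  simp [poisP, Derivation.leibniz_pow, MvPolynomial.pderiv_X_of_ne (show (0:Fin 3) ≠ 1 by decide)]
/-- `∂₂P₂ = 0`. -/
theorem pderiv_two_poisP_two : MvPolynomial.pderiv 2 (poisP 2) = 0 := by
  simp [poisP, Derivation.leibniz_pow, MvPolynomial.pderiv_X_of_ne (show (0:Fin 3) ≠ 2 by decide),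
    MvPolynomial.pderiv_X_of_ne (show (1:Fin 3) ≠ 2 by decide)]
/-- `∂₀∂₀P₂ = −2`. -/
theorem pderiv_pderiv_zero_poisP_two : MvPolynomial.pderiv 0 (MvPolynomial.pderiv 0 (poisP 2)) = -2 := by
  rw [pderiv_zero_poisP_two]
  have h2 : MvPolynomial.pderiv 0 (2 : MvPolynomial (Fin 3) ℝ) = 0 := Dou2026c.pderiv_ofNat 0 2
  simp [Derivation.leibniz, h2]
/-- `∂₁∂₁P₂ = −2`. -/
theorem pderiv_pderiv_one_poisP_two : MvPolynomial.pderiv 1 (MvPolynomial.pderiv 1 (poisP 2)) = -2 := by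
  rw [pderiv_one_poisP_two]
  have h2 : MvPolynomial.pderiv 1 (2 : MvPolynomial (Fin 3) ℝ) = 0 := Dou2026c.pderiv_ofNat 1 2
  simp [Derivation.leibniz, h2]
/-- `∂₂∂₂P₂ = 0`. -/
theorem pderiv_pderiv_two_poisP_two : MvPolynomial.pderiv 2 (MvPolynomial.pderiv 2 (poisP 2)) = 0 := by
  rw [pderiv_two_poisP_two, map_zero]

/-- `DV(x) h = −(2x₀h₀ + 2x₁h₁) e₃`. -/
theorem fderiv_poiseuille_apply (x h : E3) (i : Fin 3) :
    fderiv ℝ poiseuille x h i = if i = 2 then -(2 * x 0 * h 0 + 2 * x 1 * h 1) else 0 := by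
  rw [poiseuille_eq_polyField, fderiv_polyField_apply, Fin.sum_univ_three]
  fin_cases i
  · simp [poisP]
  · simp [poisP]
  · simp [pderiv_zero_poisP_two, pderiv_one_poisP_two, pderiv_two_poisP_two, toFun_apply]; ring

/-- `div V = 0`. -/
theorem divergence_poiseuille (x : E3) : VectorCalculus.divergence poiseuille x = 0 := by
  rw [poiseuille_eq_polyField, divergence_polyField, Fin.sum_univ_three, pderiv_two_poisP_two]
  simp [poisP]

/-- `Δ V = −4 e₃`. -/
theorem laplacian_poiseuille_apply (x : E3) (i : Fin 3) :
    Laplacian.laplacian poiseuille x i = if i = 2 then -4 else 0 := by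
  rw [poiseuille_eq_polyField, laplacian_polyField_apply, Fin.sum_univ_three]
  fin_cases i
  · simp [poisP]
  · simp [poisP]
  · simp [pderiv_pderiv_zero_poisP_two, pderiv_pderiv_one_poisP_two, pderiv_pderiv_two_poisP_two, toFun_apply]
    norm_num

/-- `∇p = −4 e₃`. -/
theorem gradient_poiseuillePressure_apply (x : E3) (i : Fin 3) :
    gradient poiseuillePressure x i = if i = 2 then -4 else 0 := by
  rw [poiseuillePressure_eq_toFun, gradient_toFun_apply]
  fin_cases i <;> simp [poisQ, Derivation.leibniz, toFun_apply]

/-! ### Assembly -/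

/-- `J₃ x = e₃ × x = (−x₁, x₀, 0)`. -/
theorem J3_apply (x : E3) : J3 x = WithLp.toLp 2 ![-(x 1), x 0, 0] := by
  ext i; fin_cases i <;> simp [J3, crossCLM_apply, cross, crossProduct]

/-- The Poiseuille field is real-analytic (a polynomial). -/
theorem analyticOnNhd_poiseuille (U : Set E3) : AnalyticOnNhd ℝ poiseuille U := by
  have h0 : AnalyticOnNhd ℝ (fun x : E3 => x 0) U := (EuclideanSpace.proj (0 : Fin 3) : E3 →L[ℝ] ℝ).analyticOnNhd U
  have h1 : AnalyticOnNhd ℝ (fun x : E3 => x 1) U := (EuclideanSpace.proj (1 : Fin 3) : E3 →L[ℝ] ℝ).analyticOnNhd U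
  have hs : AnalyticOnNhd ℝ (fun x : E3 => -(x 0 ^ 2 + x 1 ^ 2)) U := ((h0.pow 2).add (h1.pow 2)).neg
  have e : poiseuille = fun x : E3 => (-(x 0 ^ 2 + x 1 ^ 2)) • EuclideanSpace.single (2 : Fin 3) (1 : ℝ) := by
    funext x; ext i; fin_cases i <;> simp [poiseuille]
  rw [e]
  exact hs.smul analyticOnNhd_const

/-- The Poiseuille pressure is real-analytic (linear). -/
theorem analyticOnNhd_poiseuillePressure (U : Set E3) : AnalyticOnNhd ℝ poiseuillePressure U := by
  have h2 : AnalyticOnNhd ℝ (fun x : E3 => x 2) U := (EuclideanSpace.proj (2 : Fin 3) : E3 →L[ℝ] ℝ).analyticOnNhd U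
  exact analyticOnNhd_const.mul h2

/-- Hagen–Poiseuille is a classical steady Navier–Stokes flow on every set: `div V = 0`, `(V·∇)V = 0`, `∇p = ΔV = −4e₃`. -/
theorem isSteadyNSOn_poiseuille (U : Set E3) : IsSteadyNSOn U poiseuille poiseuillePressure := by
  refine ⟨?_, ?_, fun x _ => divergence_poiseuille x, fun x _ => ?_⟩
  · rw [poiseuille_eq_polyField]; exact (contDiff_polyField poisP).contDiffOn
  · rw [poiseuillePressure_eq_toFun]; exact (contDiff_toFun poisQ).contDiffOn
  · ext i
    rw [PiLp.add_apply, fderiv_poiseuille_apply, gradient_poiseuillePressure_apply, laplacian_poiseuille_apply]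
    fin_cases i <;> simp [poiseuille]

/-- `J₃` is a non-zero skew endomorphism. -/
theorem isSkewAxis_J3 : IsSkewAxis J3 := by
  refine ⟨fun x => ?_, fun h => ?_⟩
  · rw [J3_apply]
    simp [EuclideanSpace.inner_eq_star_dotProduct, dotProduct, Fin.sum_univ_three]; ring
  · have := congrArg (fun A : E3 →L[ℝ] E3 => A (EuclideanSpace.single 0 1) 1) h
    simp [J3_apply] at this

/-- The Poiseuille base facts, assembled (see `AzimuthalCartan.poiseuilleBaseFacts` for the by-name form). -/
theorem baseFacts : PoiseuilleBaseFacts := by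
  refine ⟨⟨analyticOnNhd_poiseuille _, analyticOnNhd_poiseuillePressure _, isSteadyNSOn_poiseuille _, isSkewAxis_J3,
    fun x _ => ?_, fun x _ => ?_, ⟨xTest, mem_ball_self one_pos, ?_⟩⟩, ?_⟩
  · -- equivariance: `DV(x)(e₃ × x) = 0 = e₃ × V x`
    rw [sub_zero]
    ext i
    rw [fderiv_poiseuille_apply, J3_apply, J3_apply]
    fin_cases i
    · simp [poiseuille]
    · simp [poiseuille]
    · simp [poiseuille]; ring
  · -- no swirl
    rw [sub_zero, J3_apply]
    simp [poiseuille, EuclideanSpace.inner_eq_star_dotProduct, dotProduct, Fin.sum_univ_three]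
  · -- `curl V (xTest) = (0, 6, 0)`: read component 1
    intro h
    have h1 := congrArg (fun v : E3 => v 1) h
    simp only [curl, PiLp.zero_apply] at h1
    simp [fderiv_poiseuille_apply, xTest] at h1
  · -- not (−1)-homogeneous about 0: at xTest, `(DV x x)₂ = −18 ≠ 9 = (−V x)₂`
    intro hhom
    have h := congrArg (fun v : E3 => v 2) (hhom xTest (mem_ball_self one_pos))
    simp [fderiv_poiseuille_apply, poiseuille, xTest] at h
    norm_num at h

end Poiseuille

/-- ★ **L′ `PoiseuilleBaseFacts` BY NAME** (sketch v1.3c l.284, Defs twin verbatim): the Hagen–Poiseuille base is an admissible axisymmetric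
base on `ball xTest 1` about `(0, J₃)` and is not `(−1)`-homogeneous about `0`. -/
theorem poiseuilleBaseFacts : PoiseuilleBaseFacts := Poiseuille.baseFacts

end Summit.NavierStokesRegularity.NavierStokesRegularity.Theorems.PoloidalLiouville.AzimuthalCartan
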